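import Literature.NumberTheory.CubicFields.PureCubicLexMinGamma
import Literature.NumberTheory.CubicFields.PureCubicLexMinNumerics
import Literature.NumberTheory.CubicFields.PureCubicLexMinTransform
import Literature.NumberTheory.CubicFields.PureCubicLexMinSemantics
import Literature.NumberTheory.CubicFields.PureCubicLexMinScales
import Literature.Algebra.EuclideanLattices.ShortVectorBoxFinThree
import HarnessLib

/-!
# The program `lexE` finds the cylinder minimum: completeness at the true scale, and the specification

Topic `NumberTheory/CubicFields`, sub-namespace `PureCubicLexMin`. Let `I` be the fractional ideal of a
canonical lattice code `(den, [h11, …, h33])` of `K = ℚ(θ)`, `θ³ = ab²`, and `γ ∈ I` the element of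
least real conjugate in the open unit cylinder `{σ₁ > 0, ‖σ₂‖ < 1}` (`exists_cylinder_min`), with
coordinate row `cγ`. **`coords_mem_perScale`**: at the scale `s = ⌊log₂ σ₁ γ⌋`, with a budget making
`24 δ ≤ μ`, the row `cγ H` is among the candidates of `perScale … N s` (`bt_approx`, `embMatrix_conorm`,
`half_le_norm_vecMul`, `norm_vecMul_coords_le_two`, `det_ne_zero_of_approx`, `SimApproxLLL.lllOut_spec`,
`exists_transform_of_lattice_eq`, `uEntry_eval_eq`, `shortVectorBox_fin_three`; the two rank-`3` lattice
facts `hC1`, `hC2` are hypotheses). **`lexE_spec`**: the specification of `lexE` (`PureCubicLexMinProgram`)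
— on a canonical code of a nonzero fractional ideal (`|d_K| ≤ 27 (ab²)²` a hypothesis) the output has
denominator `≥ 1`, its value is in the lattice and in the cylinder, and its real conjugate is least
there: the scale of `γ` is scanned since `1/den³ < σ₁ γ ≤ 3 N(I) √|d_K|`, its row is a valid candidate,
and the exact selection returns a valid candidate of real conjugate `≤ σ₁ γ` (Buchmann 1987 §3; Cohen
GTM 138 §6.5).

## References

* J. Buchmann, *On the computation of units and class numbers by a generalization of Lagrange's
  algorithm*, J. Number Theory 26 (1987), §3. [folklore]
* H. Cohen, *A Course in Computational Algebraic Number Theory*, GTM 138 (1993), §2.7.3, §6.5. [Cohen1993]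
-/

noncomputable section

namespace Literature.NumberTheory.CubicFields

namespace PureCubicLexMin

open Matrix Literature.Algebra.EuclideanLattices PureCubicCodes Literature.Computability.Complexity
  Literature.Computability.Complexity.RegProg Literature.Computability.Complexity.LMat
  Literature.Algebra.EuclideanLattices.GapCodes
open scoped NumberField ComplexConjugate nonZeroDivisors

section Complete

variable {K : Type*} [Field K] [NumberField K] {a b : ℕ} {θ : K} (σ₁ : K →+* ℝ) (σ₂ : K →+* ℂ)
  (hdeg : Module.finrank ℚ K = 3) (hab : Squarefree (a * b)) (hab1 : a * b ≠ 1)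
  (hθ : θ ^ 3 = ((a * b ^ 2 : ℕ) : K)) (hσ₂ : ∃ z : K, conj (σ₂ z) ≠ σ₂ z)
  {den : ℕ} (hden : den ≠ 0) {h11 h12 h13 h22 h23 h33 : ℤ}
  (h11pos : 0 < h11) (h22pos : 0 < h22) (h33pos : 0 < h33)
  {I : FractionalIdeal (𝓞 K)⁰ K}
  (hI : ∀ φ : K, Mem θ b (den, [h11, h12, h13, h22, h23, h33]) φ ↔ φ ∈ I)
include hdeg hab hab1 hθ hσ₂ hden h11pos h22pos h33pos hI

/-- **Completeness at the true scale.** See the module docstring. [cite: Cohen1993, §6.5] -/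
theorem coords_mem_perScale
    (hC1 : ∀ (b : Fin 3 → EuclideanSpace ℝ (Fin 3)), LinearIndependent ℝ b → IsLLLReduced (3 / 4) b →
      ∀ (m ρ : ℝ), 0 < m → (∀ c : Fin 3 → ℤ, c ≠ 0 → m ≤ ‖∑ i, (c i : ℝ) • b i‖) →
        ∀ c : Fin 3 → ℤ, ‖∑ i, (c i : ℝ) • b i‖ ≤ ρ → ∀ i, |(c i : ℝ)| ≤ 4 * ρ / m + 2)
    (hC2 : ∀ (B B' : Matrix (Fin 3) (Fin 3) ℝ) (δ μ : ℝ), 0 ≤ δ → 0 < μ →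
      (∀ i j, |B i j - B' i j| ≤ δ) → (∀ v : Fin 3 → ℝ, μ * ‖v‖ ≤ ‖Matrix.vecMul v B‖) → 3 * δ < μ →
      ∀ c : Fin 3 → ℤ,
        ‖Matrix.vecMul (fun i => (c i : ℝ)) B'‖ ≤ ‖Matrix.vecMul (fun i => (c i : ℝ)) B‖ * (1 + 3 * δ / μ) ∧
        ‖Matrix.vecMul (fun i => (c i : ℝ)) B‖ * (1 - 3 * δ / μ) ≤ ‖Matrix.vecMul (fun i => (c i : ℝ)) B'‖)
    (ha : 1 ≤ a) (hb : 1 ≤ b) (hab2 : 2 ≤ a * b)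
    {Hm : ℕ} (hHm : 1 ≤ Hm) (b11 : |(h11 : ℝ)| ≤ Hm) (b12 : |(h12 : ℝ)| ≤ Hm) (b13 : |(h13 : ℝ)| ≤ Hm)
    (b22 : |(h22 : ℝ)| ≤ Hm) (b23 : |(h23 : ℝ)| ≤ Hm) (b33 : |(h33 : ℝ)| ≤ Hm)
    {γ : K} (hγpos : 0 < σ₁ γ) (hγ1 : ‖σ₂ γ‖ < 1)
    (hleast : ∀ φ : K, φ ∈ I → 0 < σ₁ φ → ‖σ₂ φ‖ < 1 → σ₁ γ ≤ σ₁ φ)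
    {cγ : Fin 3 → ℤ}
    (hcγ : (den : K) * γ = lin θ b (cγ 0 * h11, cγ 0 * h12 + cγ 1 * h22, cγ 0 * h13 + cγ 1 * h23 + cγ 2 * h33))
    {s : ℤ} (hs : s = Int.log 2 (σ₁ γ)) {N : ℕ} (hsN : s.natAbs ≤ N)
    (hprec : 24 * (6 * 2 ^ s.natAbs * (Hm : ℝ) * ((a : ℝ) * b) / 2 ^ N) ≤
      min ((2 : ℝ) ^ s)⁻¹ 1 / (18 * ((a : ℝ) * b) ^ 2 * (Hm : ℝ) ^ 2 * den)) :
    [cγ 0 * h11, cγ 0 * h12 + cγ 1 * h22, cγ 0 * h13 + cγ 1 * h23 + cγ 2 * h33] ∈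
      perScale ((a, b), (den, [h11, h12, h13, h22, h23, h33])) N s := by
  have hden' : 0 < den := Nat.pos_of_ne_zero hden
  -- the scale
  set X : ℝ := (2 : ℝ) ^ s with hXdef
  have hX : 0 < X := by positivity
  obtain ⟨hXγ, h2X⟩ : X ≤ σ₁ γ ∧ σ₁ γ < 2 * X := by rw [hXdef, hs]; exact zpow_log_le_and_lt hγpos
  -- the true matrix `B_X`
  set B := embMatrix (t1 a b) (t2 a b) X den [h11, h12, h13, h22, h23, h33] with hBdef
  have hh6 : ∀ i, i < 6 → |(([h11, h12, h13, h22, h23, h33] : List ℤ).getD i 0 : ℝ)| ≤ Hm := by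
    intro i hi
    interval_cases i <;> simpa
  have hco := embMatrix_conorm ha hb hden hX [h11, h12, h13, h22, h23, h33] hh6
    (by simpa using (show (1 : ℤ) ≤ h11 by omega)) (by simpa using (show (1 : ℤ) ≤ h22 by omega))
    (by simpa using (show (1 : ℤ) ≤ h33 by omega))
  set μ : ℝ := min X⁻¹ 1 / (18 * (a * b : ℝ) ^ 2 * (Hm : ℝ) ^ 2 * den) with hμdef
  have habR : (1 : ℝ) ≤ (a : ℝ) * b := by exact_mod_cast Nat.one_le_iff_ne_zero.2 (by positivity)
  have hμ : 0 < μ := by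
    rw [hμdef]
    refine div_pos (lt_min (inv_pos.2 hX) one_pos) ?_
    have : (1 : ℝ) ≤ Hm := by exact_mod_cast hHm
    positivity
  have hshort : ∀ c : Fin 3 → ℤ, c ≠ 0 → 1 / 2 ≤ ‖(fun i => (c i : ℝ)) ᵥ* B‖ := fun c hc =>
    half_le_norm_vecMul σ₁ σ₂ hdeg hab hab1 hθ hσ₂ hden hI h11pos.ne' h22pos.ne' h33pos.ne' hleast hX hXγ hc
  have hγb : ‖(fun i => (cγ i : ℝ)) ᵥ* B‖ ≤ 2 :=
    norm_vecMul_coords_le_two σ₁ σ₂ hdeg hab hab1 hθ hσ₂ hden hcγ hγpos hγ1 hX h2X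
  -- the rounded matrix `B̃`
  set bt := btExprs.map (Ex.eval N (regs0 ((a, b), (den, [h11, h12, h13, h22, h23, h33])) N s)) with hbtdef
  set Bt : Matrix (Fin 3) (Fin 3) ℤ := toMat 3 3 (rowsOfFlat 3 bt) with hBtdef
  set P : ℝ := (2 : ℝ) ^ N with hPdef
  have hP : 0 < P := by positivity
  set δ : ℝ := 6 * 2 ^ s.natAbs * (Hm : ℝ) * ((a : ℝ) * b) / P with hδdef
  have hδ : 0 ≤ δ := by positivity
  have hHmR : (1 : ℝ) ≤ Hm := by exact_mod_cast hHm
  have happrox : ∀ i j, |B i j - (Bt i j : ℝ) / P| ≤ δ := by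
    intro i j
    have h := bt_approx ha hb hab2 hden' h11 h12 h13 h22 h23 h33 hHmR b12 b13 b22 b23 b33 N s hsN i j
    rw [← hbtdef] at h
    rw [hBtdef, toMat_rowsOfFlat, hδdef, le_div_iff₀ hP]
    have hPne : P ≠ 0 := hP.ne'
    rw [show |B i j - ((bt.getD ((i : ℕ) * 3 + j) 0 : ℤ) : ℝ) / P| * P =
      |((bt.getD ((i : ℕ) * 3 + j) 0 : ℤ) : ℝ) - 2 ^ N * B i j| by
      rw [← abs_of_pos hP, ← abs_mul, abs_of_pos hP, ← abs_neg, hPdef]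
      congr 1
      field_simp
      ring]
    exact h
  have h24 : 24 * δ ≤ μ := hprec
  -- nonsingularity and the LLL output
  have hdet : Bt.det ≠ 0 := det_ne_zero_of_approx hC2 B Bt hδ hμ h24 happrox hco hshort
  set I₀ : LatticeInstance := ⟨3, Bt⟩ with hI₀
  have hns : I₀.IsNonsingular := hdet
  obtain ⟨hlat, hred⟩ := SimApproxLLL.lllOut_spec hns
  set L : Matrix (Fin 3) (Fin 3) ℤ := (SimApproxLLL.lllOut I₀).basis with hLdef
  have hL3 : SimApproxLLL.lllOut I₀ = ⟨3, L⟩ := rfl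
  have hlat' : (⟨3, L⟩ : LatticeInstance).lattice = (⟨3, Bt⟩ : LatticeInstance).lattice := hlat
  obtain ⟨U, V, hU, hV⟩ := exists_transform_of_lattice_eq Bt L hlat'
  have hred' : IsLLLReduced (3 / 4) (⟨3, L⟩ : LatticeInstance).vec := hred
  obtain ⟨-, -, hcoord, hbox⟩ := shortVectorBox_fin_three hC1 hC2 B Bt L U V hP hδ hμ h24 happrox hco
    hshort cγ hγb hU hV hred'
  -- the program's `U` is `U`
  have hUprog : ∀ i j : Fin 3, Ex.eval 0 (bt ++ lll9 bt) (uEntry i j) = U i j := by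
    intro i j
    have hbt9 := eq_flat_toMat bt (by rw [hbtdef]; exact length_btExprs_map _)
    have hl9 := lll9_eq bt L hL3
    rw [hl9]
    conv_lhs => rw [hbt9]
    exact uEntry_eval_eq Bt L U hdet hU i j
  -- membership through `mem_perScale_iff`
  set c' := cγ ᵥ* V with hc'
  have hcomp : ∀ j : Fin 3, c' 0 * U 0 j + c' 1 * U 1 j + c' 2 * U 2 j = cγ j := by
    intro j
    have := congr_fun hcoord j
    rw [Matrix.vecMul, dotProduct, Fin.sum_univ_three] at this
    exact this
  refine (mem_perScale_iff a b den h11 h12 h13 h22 h23 h33 N s _).2 ⟨c' 0, c' 1, c' 2, ?_, ?_, ?_, ?_⟩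
  · exact_mod_cast hbox 0
  · exact_mod_cast hbox 1
  · exact_mod_cast hbox 2
  · rw [← hbtdef]
    have e00 : Ex.eval 0 (bt ++ lll9 bt) (uEntry 0 0) = U 0 0 := hUprog 0 0
    have e01 : Ex.eval 0 (bt ++ lll9 bt) (uEntry 0 1) = U 0 1 := hUprog 0 1
    have e02 : Ex.eval 0 (bt ++ lll9 bt) (uEntry 0 2) = U 0 2 := hUprog 0 2
    have e10 : Ex.eval 0 (bt ++ lll9 bt) (uEntry 1 0) = U 1 0 := hUprog 1 0
    have e11 : Ex.eval 0 (bt ++ lll9 bt) (uEntry 1 1) = U 1 1 := hUprog 1 1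
    have e12 : Ex.eval 0 (bt ++ lll9 bt) (uEntry 1 2) = U 1 2 := hUprog 1 2
    have e20 : Ex.eval 0 (bt ++ lll9 bt) (uEntry 2 0) = U 2 0 := hUprog 2 0
    have e21 : Ex.eval 0 (bt ++ lll9 bt) (uEntry 2 1) = U 2 1 := hUprog 2 1
    have e22 : Ex.eval 0 (bt ++ lll9 bt) (uEntry 2 2) = U 2 2 := hUprog 2 2
    beta_reduce
    rw [e00, e01, e02, e10, e11, e12, e20, e21, e22, hcomp 0, hcomp 1, hcomp 2]

end Complete

section Spec

open Literature.NumberTheory.NumberFields.PureCubic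
open Literature.Computability.Complexity.CodeFP (natE intE lt_two_pow_length_natE)

/-- A candidate that is not `isLt`-below another has real conjugate at least as large. [folklore] -/
theorem sigma1_row_le_of_isLt_false {K : Type*} [Field K] [NumberField K] {a b : ℕ} {θ : K}
    (σ₁ : K →+* ℝ) (σ₂ : K →+* ℂ) (hdeg : Module.finrank ℚ K = 3) (hab : Squarefree (a * b))
    (hab1 : a * b ≠ 1) (hθ : θ ^ 3 = ((a * b ^ 2 : ℕ) : K)) (hσ₂ : ∃ z : K, conj (σ₂ z) ≠ σ₂ z)
    {den : ℕ} (hden : den ≠ 0) (hs : List ℤ) (x' y' z' x y z : ℤ)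
    (h : isLt ((a, b), (den, hs)) [x', y', z'] [x, y, z] = false) :
    σ₁ (lin θ b (x, y, z) / (den : K)) ≤ σ₁ (lin θ b (x', y', z') / (den : K)) := by
  by_contra hcon
  push Not at hcon
  have h' := (sigma1_lin_div_lt_iff hdeg hab hab1 hθ σ₁ σ₂ hσ₂ (x, y, z) (x', y', z') den hden).1 hcon
  have : isLt ((a, b), (den, hs)) [x', y', z'] [x, y, z] = true :=
    (isLt_eq_true_iff a b den hs x' y' z' x y z).2 (by simpa using h')
  rw [h] at this
  exact Bool.false_ne_true this

set_option maxHeartbeats 400000 in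
/-- **Specification of `lexE`.** See the module docstring. [cite: Cohen1993, §6.5] -/
theorem lexE_spec
    (hC1 : ∀ (b : Fin 3 → EuclideanSpace ℝ (Fin 3)), LinearIndependent ℝ b → IsLLLReduced (3 / 4) b →
      ∀ (m ρ : ℝ), 0 < m → (∀ c : Fin 3 → ℤ, c ≠ 0 → m ≤ ‖∑ i, (c i : ℝ) • b i‖) →
        ∀ c : Fin 3 → ℤ, ‖∑ i, (c i : ℝ) • b i‖ ≤ ρ → ∀ i, |(c i : ℝ)| ≤ 4 * ρ / m + 2)
    (hC2 : ∀ (B B' : Matrix (Fin 3) (Fin 3) ℝ) (δ μ : ℝ), 0 ≤ δ → 0 < μ →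
      (∀ i j, |B i j - B' i j| ≤ δ) → (∀ v : Fin 3 → ℝ, μ * ‖v‖ ≤ ‖Matrix.vecMul v B‖) → 3 * δ < μ →
      ∀ c : Fin 3 → ℤ,
        ‖Matrix.vecMul (fun i => (c i : ℝ)) B'‖ ≤ ‖Matrix.vecMul (fun i => (c i : ℝ)) B‖ * (1 + 3 * δ / μ) ∧
        ‖Matrix.vecMul (fun i => (c i : ℝ)) B‖ * (1 - 3 * δ / μ) ≤ ‖Matrix.vecMul (fun i => (c i : ℝ)) B'‖)
    (a b : ℕ) (hab : Squarefree (a * b)) (hab1 : a * b ≠ 1)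
    (K : Type) [Field K] [NumberField K] (hdeg : Module.finrank ℚ K = 3)
    (hdisc : |NumberField.discr K| ≤ 27 * ((a * b ^ 2 : ℕ) : ℤ) ^ 2)
    (θ : K) (hθ : θ ^ 3 = ((a * b ^ 2 : ℕ) : K))
    (σ₁ : K →+* ℝ) (σ₂ : K →+* ℂ) (hσ₂ : ∃ z : K, conj (σ₂ z) ≠ σ₂ z)
    (c : ℕ × List ℤ) (hc : Canon c)
    (hcI : ∃ I : FractionalIdeal (𝓞 K)⁰ K, I ≠ 0 ∧ ∀ φ : K, Mem θ b c φ ↔ φ ∈ I) :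
    1 ≤ (lexE ((a, b), c)).2.2.2 ∧ Mem θ b c (val θ b (lexE ((a, b), c))) ∧
      0 < σ₁ (val θ b (lexE ((a, b), c))) ∧ ‖σ₂ (val θ b (lexE ((a, b), c)))‖ < 1 ∧
      ∀ φ : K, Mem θ b c φ → 0 < σ₁ φ → ‖σ₂ φ‖ < 1 → σ₁ (val θ b (lexE ((a, b), c))) ≤ σ₁ φ := by
  obtain ⟨den, hs⟩ := c
  obtain ⟨h11, h12, h13, h22, h23, h33, hhs, h11pos, h22pos, h33pos, -, -, -, -, -, -, hden1, -⟩ := hc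
  simp only at hhs hden1
  subst hhs
  obtain ⟨⟨I, hI0, hI⟩, ⟨ha0, hb0⟩⟩ := And.intro hcI (ne_zero_of_squarefree_mul hab)
  obtain ⟨ha, hb⟩ : 1 ≤ a ∧ 1 ≤ b := ⟨Nat.one_le_iff_ne_zero.2 ha0, Nat.one_le_iff_ne_zero.2 hb0⟩
  have hab2 : 2 ≤ a * b := by have : a * b ≠ 0 := mul_ne_zero ha0 hb0; omega
  have hden : den ≠ 0 := by omega
  obtain ⟨haL, hbL, hdL, hhL, hsum, hsumh⟩ := bounds_of_input a b den [h11, h12, h13, h22, h23, h33]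
  set L := (inE ((a, b), (den, [h11, h12, h13, h22, h23, h33]))).length with hLdef
  set inp : (ℕ × ℕ) × (ℕ × List ℤ) := ((a, b), (den, [h11, h12, h13, h22, h23, h33])) with hinp
  obtain ⟨γ, hγI, hγpos, hγ1, hleast, -, -, -, hγle⟩ := exists_cylinder_min hdeg hσ₂ hI0
  obtain ⟨u, v, w, hcγ'⟩ := (mem_iff_exists_coords hI γ).1 hγI
  set cγ : Fin 3 → ℤ := ![u, v, w] with hcγdef
  have hcγ : (den : K) * γ = lin θ b (cγ 0 * h11, cγ 0 * h12 + cγ 1 * h22, cγ 0 * h13 + cγ 1 * h23 + cγ 2 * h33) := by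
    simpa [hcγdef] using hcγ'
  have hγval : lin θ b (cγ 0 * h11, cγ 0 * h12 + cγ 1 * h22, cγ 0 * h13 + cγ 1 * h23 + cγ 2 * h33) / (den : K) = γ := by
    rw [← hcγ, mul_div_cancel_left₀ _ (Nat.cast_ne_zero.2 hden)]
  set Hm : ℕ := max (max (max h11.natAbs h12.natAbs) (max h13.natAbs h22.natAbs)) (max h23.natAbs h33.natAbs)
    with hHmdef
  have hHm1 : 1 ≤ Hm := (show 1 ≤ h11.natAbs by omega).trans (by simp [hHmdef])
  have hHmL : Hm < 2 ^ L := by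
    simp only [hHmdef, max_lt_iff]
    exact ⟨⟨⟨hhL h11 (by simp), hhL h12 (by simp)⟩, hhL h13 (by simp), hhL h22 (by simp)⟩,
      hhL h23 (by simp), hhL h33 (by simp)⟩
  have hbnd : ∀ z : ℤ, z.natAbs ≤ Hm → |(z : ℝ)| ≤ Hm := fun z hz => by
    rw [← Int.cast_abs]; exact_mod_cast (Int.natCast_natAbs z ▸ (Int.ofNat_le.2 hz : ((z.natAbs : ℕ) : ℤ) ≤ Hm))
  obtain ⟨b11, b12, b13, b22, b23, b33⟩ : |(h11 : ℝ)| ≤ Hm ∧ |(h12 : ℝ)| ≤ Hm ∧ |(h13 : ℝ)| ≤ Hm ∧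
      |(h22 : ℝ)| ≤ Hm ∧ |(h23 : ℝ)| ≤ Hm ∧ |(h33 : ℝ)| ≤ Hm :=
    ⟨hbnd h11 (by simp [hHmdef]), hbnd h12 (by simp [hHmdef]), hbnd h13 (by simp [hHmdef]),
      hbnd h22 (by simp [hHmdef]), hbnd h23 (by simp [hHmdef]), hbnd h33 (by simp [hHmdef])⟩
  set s : ℤ := Int.log 2 (σ₁ γ) with hsdef
  have hslo : -(3 * ((natE den).length : ℤ)) ≤ s := by
    have h1 := inv_pow_lt_sigma1 σ₁ σ₂ hdeg hab hab1 hθ hσ₂ hden hcγ hγpos hγ1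
    have hdlt : (den : ℝ) < 2 ^ (natE den).length := by exact_mod_cast lt_two_pow_length_natE den
    have h2 : ((2 : ℝ) ^ (3 * (natE den).length))⁻¹ < σ₁ γ := by
      refine lt_of_le_of_lt ?_ h1
      rw [one_div, inv_le_inv₀ (by positivity) (by positivity), pow_mul']
      exact pow_le_pow_left₀ (by positivity) hdlt.le 3
    have := int_log_lower h2
    push_cast at this; exact this
  have hshi : s < 5 + 3 * (((natE a).length : ℤ) + (natE b).length + (intE h33).length) := by
    -- `σ₁ γ ≤ 3 N(I) √|d| ≤ 3 (a²b h33³) (6 a b²) < 2^5 · 2^{3(La+Lb+Lh)}`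
    have hr3 := rowLin_div_mem hden hI (![(0 : ℤ), 0, 1] : Fin 3 → ℤ)
    simp only [Matrix.cons_val_zero, Matrix.cons_val_one, Matrix.head_cons, Matrix.cons_val_two,
      Matrix.tail_cons, zero_mul, zero_add, one_mul] at hr3
    have hr30 : lin θ b ((0 : ℤ), (0 : ℤ), h33) / (den : K) ≠ 0 := by
      have h := rowLin_ne_zero (h12 := h12) (h13 := h13) (h23 := h23) hdeg hab hab1 hθ h11pos.ne'
        h22pos.ne' h33pos.ne' (c := (![(0 : ℤ), 0, 1] : Fin 3 → ℤ))
        (by intro h0; have := congr_fun h0 2; simp at this)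
      simp only [Matrix.cons_val_zero, Matrix.cons_val_one, Matrix.head_cons, Matrix.cons_val_two,
        Matrix.tail_cons, zero_mul, zero_add, one_mul] at h
      exact div_ne_zero h (Nat.cast_ne_zero.2 hden)
    have hNI := absNorm_le_abs_mul_norm_sq hdeg hσ₂ σ₁ hI0 hr3 hr30
    rw [← abs_of_nonneg (sq_nonneg ‖σ₂ (lin θ b ((0 : ℤ), (0 : ℤ), h33) / (den : K))‖), ← abs_mul,
      ← norm_eq_mul_norm_sq σ₁ σ₂ hdeg hσ₂, norm_lin_div hdeg hab hab1 hθ _ den hden] at hNI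
    have hnr : normRow a b ((0 : ℤ), (0 : ℤ), h33) = a ^ 2 * b * h33 ^ 3 := by simp [normRow]
    rw [hnr] at hNI
    have hdisc' : Real.sqrt |(NumberField.discr K : ℝ)| ≤ 6 * a * (b : ℝ) ^ 2 := by
      have h' : (((|NumberField.discr K|) : ℤ) : ℝ) ≤ (((27 * ((a * b ^ 2 : ℕ) : ℤ) ^ 2) : ℤ) : ℝ) := by
        exact_mod_cast hdisc
      rw [Int.cast_abs] at h'
      push_cast at h'
      have hX := sq_nonneg ((a : ℝ) * b ^ 2)
      have h36 : |(NumberField.discr K : ℝ)| ≤ (6 * a * (b : ℝ) ^ 2) ^ 2 := by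
        rw [show (6 * a * (b : ℝ) ^ 2) ^ 2 = 36 * ((a : ℝ) * b ^ 2) ^ 2 by ring]
        linarith
      calc Real.sqrt |(NumberField.discr K : ℝ)| ≤ Real.sqrt ((6 * a * (b : ℝ) ^ 2) ^ 2) :=
            Real.sqrt_le_sqrt h36
        _ = 6 * a * (b : ℝ) ^ 2 := Real.sqrt_sq (by positivity)
    have haL' : (a : ℝ) < 2 ^ (natE a).length := by exact_mod_cast lt_two_pow_length_natE a
    have hbL' : (b : ℝ) < 2 ^ (natE b).length := by exact_mod_cast lt_two_pow_length_natE b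
    have h33L : |(h33 : ℝ)| < 2 ^ (intE h33).length := by
      have h := Literature.Computability.QuantumComplexity.natAbs_lt_two_pow_length_intE h33
      have h' : ((h33.natAbs : ℕ) : ℝ) < 2 ^ (intE h33).length := by exact_mod_cast h
      rwa [Nat.cast_natAbs, Int.cast_abs] at h'
    have hNI'' : ((FractionalIdeal.absNorm I : ℚ) : ℝ) ≤ (a : ℝ) ^ 2 * b * |(h33 : ℝ)| ^ 3 := by
      refine hNI.trans ?_
      rw [Rat.cast_div, abs_div]
      have hd3 : (1 : ℝ) ≤ |(((den : ℚ) ^ 3 : ℚ) : ℝ)| := by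
        push_cast; rw [abs_of_nonneg (by positivity)]
        exact one_le_pow₀ (by exact_mod_cast Nat.one_le_iff_ne_zero.2 hden)
      refine (div_le_self (abs_nonneg _) hd3).trans (le_of_eq ?_)
      push_cast
      rw [abs_mul, abs_mul, abs_pow, abs_of_nonneg (by positivity : (0 : ℝ) ≤ a),
        abs_of_nonneg (by positivity : (0 : ℝ) ≤ b), abs_pow]
    have hup : σ₁ γ < (2 : ℝ) ^ (5 + 3 * ((natE a).length + (natE b).length + (intE h33).length)) := by
      have hN0 : (0 : ℝ) ≤ ((FractionalIdeal.absNorm I : ℚ) : ℝ) := by exact_mod_cast FractionalIdeal.absNorm_nonneg I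
      have hY : (0 : ℝ) < (2 : ℝ) ^ (natE a).length * 2 ^ (natE b).length * 2 ^ (intE h33).length := by positivity
      have hprod : (a : ℝ) * b * |(h33 : ℝ)| < 2 ^ (natE a).length * 2 ^ (natE b).length * 2 ^ (intE h33).length := by
        have h33pos' : (0 : ℝ) < |(h33 : ℝ)| := abs_pos.2 (by exact_mod_cast h33pos.ne')
        calc (a : ℝ) * b * |(h33 : ℝ)| < 2 ^ (natE a).length * b * |(h33 : ℝ)| := by gcongr
          _ ≤ 2 ^ (natE a).length * 2 ^ (natE b).length * |(h33 : ℝ)| := by gcongr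
          _ < 2 ^ (natE a).length * 2 ^ (natE b).length * 2 ^ (intE h33).length := by gcongr
      have h0 : (0 : ℝ) ≤ (a : ℝ) * b * |(h33 : ℝ)| := by positivity
      have h3 := pow_lt_pow_left₀ hprod h0 (by norm_num : (3 : ℕ) ≠ 0)
      have hY3 : (0 : ℝ) < (2 ^ (natE a).length * 2 ^ (natE b).length * 2 ^ (intE h33).length) ^ 3 := by positivity
      calc σ₁ γ ≤ 3 * ((FractionalIdeal.absNorm I : ℚ) : ℝ) * Real.sqrt |(NumberField.discr K : ℝ)| := hγle
        _ ≤ 3 * ((a : ℝ) ^ 2 * b * |(h33 : ℝ)| ^ 3) * (6 * a * (b : ℝ) ^ 2) :=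
            mul_le_mul (mul_le_mul_of_nonneg_left hNI'' (by norm_num)) hdisc' (Real.sqrt_nonneg _) (by positivity)
        _ = 18 * ((a : ℝ) * b * |(h33 : ℝ)|) ^ 3 := by ring
        _ < 32 * ((2 : ℝ) ^ (natE a).length * 2 ^ (natE b).length * 2 ^ (intE h33).length) ^ 3 := by linarith
        _ = (2 : ℝ) ^ (5 + 3 * ((natE a).length + (natE b).length + (intE h33).length)) := by
            rw [show (2 : ℝ) ^ (natE a).length * 2 ^ (natE b).length * 2 ^ (intE h33).length =
              2 ^ ((natE a).length + (natE b).length + (intE h33).length) by rw [pow_add, pow_add],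
              ← pow_mul, show (32 : ℝ) = 2 ^ 5 by norm_num, ← pow_add, Nat.mul_comm]
    have := int_log_upper hγpos hup
    push_cast at this; linarith
  have hsS : s.natAbs ≤ halfWidth inp := by
    have h33m : h33 ∈ [h11, h12, h13, h22, h23, h33] := by simp
    have := hsumh h33 h33m
    have hS : halfWidth inp = 3 * L + 8 := by simp only [halfWidth, hLdef]
    rw [hS]
    have : (natE den).length ≤ L := by omega
    omega
  have hS' : halfWidth inp = 3 * L + 8 := by simp only [halfWidth, hLdef]
  have hB' : budget inp = 16 * L + 64 := by simp only [budget, hLdef]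
  have hsN : s.natAbs ≤ budget inp := by omega
  have hprec := precision_ineq (L := L) haL hbL hdL hHmL ha hb (Nat.one_le_iff_ne_zero.2 hden) hHm1 s
    (by omega)
  have hmem : [cγ 0 * h11, cγ 0 * h12 + cγ 1 * h22, cγ 0 * h13 + cγ 1 * h23 + cγ 2 * h33] ∈
      perScale inp (budget inp) s :=
    coords_mem_perScale σ₁ σ₂ hdeg hab hab1 hθ hσ₂ hden h11pos h22pos h33pos hI hC1 hC2 ha hb hab2 hHm1
      b11 b12 b13 b22 b23 b33 hγpos hγ1 hleast hcγ rfl hsN (by rw [hB']; exact hprec)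
  set wγ : List ℤ := [cγ 0 * h11, cγ 0 * h12 + cγ 1 * h22, cγ 0 * h13 + cγ 1 * h23 + cγ 2 * h33] with hwγ
  have hwall : wγ ∈ allCands inp :=
    (mem_allCands_iff inp wγ).2 ⟨s, by omega, by omega, hmem⟩
  have hwcyl : inCyl inp wγ = true := by
    rw [hwγ, inCyl_eq_true_iff]
    have hγpos' : 0 < σ₁ (lin θ b (cγ 0 * h11, cγ 0 * h12 + cγ 1 * h22, cγ 0 * h13 + cγ 1 * h23 + cγ 2 * h33) /
        (den : K)) := by rw [hγval]; exact hγpos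
    have hγ1' : ‖σ₂ (lin θ b (cγ 0 * h11, cγ 0 * h12 + cγ 1 * h22, cγ 0 * h13 + cγ 1 * h23 + cγ 2 * h33) /
        (den : K))‖ < 1 := by rw [hγval]; exact hγ1
    have hp := (sigma1_lin_div_pos_iff hdeg hab hab1 hθ σ₁ σ₂ hσ₂ _ den hden).1 hγpos'
    exact ⟨hp, (norm_sigma2_lin_div_lt_one_iff hdeg hab hab1 hθ σ₁ σ₂ hσ₂ _ den hden hγpos').1 hγ1'⟩
  have hwvalid : wγ ∈ validCands inp := (mem_validCands_iff inp wγ).2 ⟨hwall, hwcyl⟩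
  let f : List ℤ → ℝ := fun w => σ₁ (lin θ b (w.getD 0 0, w.getD 1 0, w.getD 2 0) / (den : K))
  obtain ⟨wm, hwm, hmin⟩ := (validCands inp).toFinset.exists_min_image f ⟨wγ, List.mem_toFinset.2 hwvalid⟩
  rw [List.mem_toFinset] at hwm
  have hwm_min : wm ∈ minCands inp := by
    rw [mem_minCands_iff]
    refine ⟨hwm, fun w' hw' => ?_⟩
    obtain ⟨x', y', z', rfl⟩ := exists_eq_triple_of_mem_allCands ((mem_validCands_iff inp w').1 hw').1
    obtain ⟨x, y, z, hxyz⟩ := exists_eq_triple_of_mem_allCands ((mem_validCands_iff inp wm).1 hwm).1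
    rw [hxyz]
    rw [Bool.eq_false_iff]
    intro hlt
    have h1 := (isLt_eq_true_iff a b den _ x' y' z' x y z).1 hlt
    have h2 := (sigma1_lin_div_lt_iff hdeg hab hab1 hθ σ₁ σ₂ hσ₂ (x, y, z) (x', y', z') den hden).2 h1
    have h3 := hmin [x', y', z'] (List.mem_toFinset.2 hw')
    simp only [f, hxyz, List.getD_cons_zero, List.getD_cons_succ] at h3
    linarith
  obtain ⟨wout, hwout, hlex⟩ := exists_lexE_eq_of_ne_nil (List.ne_nil_of_mem hwm_min)
  obtain ⟨hwoutv, hwoutmin⟩ := (mem_minCands_iff inp wout).1 hwout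
  obtain ⟨hwouta, hwoutc⟩ := (mem_validCands_iff inp wout).1 hwoutv
  obtain ⟨x, y, z, rfl⟩ := exists_eq_triple_of_mem_allCands hwouta
  simp only [List.getD_cons_zero, List.getD_cons_succ] at hlex
  change lexE inp = (x, y, z, den) at hlex
  rw [hlex]
  have hval : val θ b (x, y, z, den) = lin θ b (x, y, z) / (den : K) := rfl
  rw [hval]
  obtain ⟨hcpos, hccyl⟩ := (inCyl_eq_true_iff a b den _ x y z).1 hwoutc
  have hpos := (sigma1_lin_div_pos_iff hdeg hab hab1 hθ σ₁ σ₂ hσ₂ (x, y, z) den hden).2 hcpos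
  have hcyl := (norm_sigma2_lin_div_lt_one_iff hdeg hab hab1 hθ σ₁ σ₂ hσ₂ (x, y, z) den hden hpos).2 hccyl
  obtain ⟨s', -, -, hs'⟩ := (mem_allCands_iff inp _).1 hwouta
  obtain ⟨c0, c1, c2, -, -, -, hw⟩ := (mem_perScale_iff a b den h11 h12 h13 h22 h23 h33 (budget inp) s' _).1 hs'
  simp only [List.cons.injEq, and_true] at hw
  obtain ⟨P, Q, R, hx, hy, hz⟩ : ∃ P Q R : ℤ, x = P * h11 ∧ y = P * h12 + Q * h22 ∧ z = P * h13 + Q * h23 + R * h33 :=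
    ⟨_, _, _, hw.1, hw.2.1, hw.2.2⟩
  refine ⟨hden1, ?_, hpos, hcyl, fun φ hφ hφpos hφ1 => ?_⟩
  · refine ⟨h11, h12, h13, h22, h23, h33, P, Q, R, rfl, ?_⟩
    show (den : K) * (lin θ b (x, y, z) / (den : K)) = _
    rw [mul_div_cancel₀ _ (Nat.cast_ne_zero.2 hden), hx, hy, hz]
    rfl
  · -- minimality: `σ₁ (value) ≤ σ₁ γ ≤ σ₁ φ`
    have hγφ := hleast φ ((hI φ).1 hφ) hφpos hφ1
    have hle : σ₁ (lin θ b (x, y, z) / (den : K)) ≤ σ₁ γ := by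
      rw [← hγval]
      exact sigma1_row_le_of_isLt_false σ₁ σ₂ hdeg hab hab1 hθ hσ₂ hden _ _ _ _ _ _ _ (hwoutmin wγ hwvalid)
    exact hle.trans hγφ
end Spec


end PureCubicLexMin

end Literature.NumberTheory.CubicFields

end
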